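import Summits.HubbardSuperconductivity.HubbardSuperconductivity.Theorems.AnisotropyChordTransferFibre3GreenZeroKT
import Summits.HubbardSuperconductivity.HubbardSuperconductivity.Theorems.AnisotropyChordTransferFibre3ShellTermBounds
import Summits.HubbardSuperconductivity.HubbardSuperconductivity.Theorems.AnisotropyChordTransferFibre3LamPart

/-!
# Route `AnisotropyChord` / H0 rotor rung: the λ-part of the window kernel is at most `(π²/8)|r|²·λ·G̃_λ(0)`; KT-regime window values (family A)

For the family-A window row of LEVEL2-SPEC §3 (`a_λ(r) = G̃_λ(0) − G̃_λ(r)` on `|r|∞ ≤ 3` in the KT regime `λ = ν(2π/L)²`):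
the tree has `a_0(r) = aZ2 r + O(C_r/L²)` (…WindowRate, …ZSquareWindow) and the λ-part `δ_λ(r) = a_λ(r) − a_0(r) ≥ 0`
(`RateLemma.lamPartShellBound_holds`); the landed SHELL MAJORANT `|r|²(11.71 ln L + 5.9)/L²` is sized for the HOLE₂ point
`λ_H = (3/2)ε₁` and is ×30–50 above the truth in the KT regime.  Here a capacity form valid for every `0 ≤ λ < 2ε₁`:
* ★ `lamPart_le_capacity`: **`δ_λ(x,y) ≤ (π²/8)(x² + y²)·λ·G̃_λ(0)`** (`LamPartIdentity`, `1 − cos t ≤ t²/2`, the centred angle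
  `(k·r)_c² ≤ θ²(m·r)²` (`RateLemma.kdotC_sq_le`), Cauchy–Schwarz, Jordan `θ²|m|² ≤ (π²/4)·2ε(k)` per coordinate);
* ★ `lamPart_KT_le`: for `L ≥ 64`, `0 ≤ ν ≤ 0.07`, `λ = ν(2π/L)²`: **`δ_λ(x,y) ≤ ν(x² + y²)(7.76 ln L + 3.3)/L²`**
  (with `CapacityConst.capacity_KT_bounds`; e.g. `≤ .0032` at `(3,3)`, `L = 128`, `ν = .07`; truth `≈ 3·10⁻⁴`).
Prover seat `hubbard-h0-rotor-p1` g26; helper for stmt-HubbardSuperconductivity-23918 (`--supports`, helper class).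
WHAT THIS IS NOT: nothing here proves superconductivity in the Hubbard model; a family-A input of the Level-2 programme for ONE
conditional reduction (piece A of the H0/PC rotor rung).  Tree imports only; no new definitions; no sorry, no axioms.
-/

set_option linter.dupNamespace false
set_option autoImplicit false

noncomputable section

open scoped BigOperators
open Real Finset

namespace Summit.HubbardSuperconductivity.HubbardSuperconductivity.Theorems.AnisotropyChord.Transfer.Fibre3

namespace CapacityConst

variable (L : ℕ) [NeZero L]

/-- Jordan per coordinate at the centred representative: `θ²(m₁² + m₂²) ≤ (π²/4)·2ε(k)`. [folklore] -/
theorem theta_sq_normSq_le (k : Tor L) :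
    (2 * Real.pi / L) ^ 2 * ((((k.1.valMinAbs : ℤ)) : ℝ) ^ 2 + (((k.2.valMinAbs : ℤ)) : ℝ) ^ 2)
      ≤ Real.pi ^ 2 / 4 * (2 * epsT L k) := by
  have hL : (0 : ℝ) < L := by exact_mod_cast Nat.pos_of_ne_zero (NeZero.ne L)
  have hπ := Real.pi_pos
  -- `|2π m_i / L| ≤ π`
  have hang : ∀ m : ZMod L, |2 * Real.pi * (((m.valMinAbs : ℤ)) : ℝ) / L| ≤ Real.pi := by
    intro m
    have h1 : (m.valMinAbs.natAbs : ℤ) * 2 ≤ (L : ℤ) := by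
      have := ZMod.natAbs_valMinAbs_le m
      omega
    have h2 : |(((m.valMinAbs : ℤ)) : ℝ)| * 2 ≤ (L : ℝ) := by
      rw [← Int.cast_abs, Int.abs_eq_natAbs]
      exact_mod_cast h1
    rw [abs_div, abs_mul, abs_of_pos (by positivity : (0:ℝ) < 2 * Real.pi), abs_of_pos hL,
      div_le_iff₀ hL]
    nlinarith [abs_nonneg ((((m.valMinAbs : ℤ)) : ℝ))]
  have j1 := jordan_sq_le (2 * Real.pi * (((k.1.valMinAbs : ℤ)) : ℝ) / L) (hang k.1)
  have j2 := jordan_sq_le (2 * Real.pi * (((k.2.valMinAbs : ℤ)) : ℝ) / L) (hang k.2)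
  rw [two_epsT_eq_rep L k]
  have e : (2 * Real.pi / L) ^ 2 * ((((k.1.valMinAbs : ℤ)) : ℝ) ^ 2 + (((k.2.valMinAbs : ℤ)) : ℝ) ^ 2)
      = Real.pi ^ 2 / 4 * (4 / Real.pi ^ 2 * (2 * Real.pi * (((k.1.valMinAbs : ℤ)) : ℝ) / L) ^ 2
          + 4 / Real.pi ^ 2 * (2 * Real.pi * (((k.2.valMinAbs : ℤ)) : ℝ) / L) ^ 2) := by
    field_simp
  rw [e]
  exact mul_le_mul_of_nonneg_left (by linarith) (by positivity)

/-- ★ THE λ-PART IN CAPACITY FORM: `δ_λ(x,y) ≤ (π²/8)(x² + y²)·λ·G̃_λ(0)` for `0 ≤ λ < 2ε₁`, `L ≥ 4`. [folklore] -/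
theorem lamPart_le_capacity (hL : 4 ≤ L) (lam : ℝ) (h0 : 0 ≤ lam) (h1 : lam < 2 * eps1 L) (x y : ℤ) :
    RateLemma.lamPart L lam (((x : ZMod L)), ((y : ZMod L)))
      ≤ Real.pi ^ 2 / 8 * ((x : ℝ) ^ 2 + (y : ℝ) ^ 2) * lam * Gres L lam 0 := by
  have hL2 : 2 ≤ L := by omega
  have hV : (0 : ℝ) < (L : ℝ) ^ 2 := by
    have : (0 : ℝ) < L := by exact_mod_cast (show 0 < L by omega)
    positivity
  rw [RateLemma.lamPartIdentity_holds L lam h0 h1]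
  unfold RateLemma.lamPartSum Gres
  set r : Tor L := (((x : ZMod L)), ((y : ZMod L))) with hr
  set R : ℝ := (x : ℝ) ^ 2 + (y : ℝ) ^ 2 with hR
  have hR0 : 0 ≤ R := by positivity
  -- termwise: `(1 − cos(k·r)_c)/((2ε)(2ε−λ)) ≤ (π²/8) R · g_λ(k)`
  have hterm : ∀ k : Tor L,
      (if k = 0 then (0 : ℝ) else (1 - (phase L k r).re) / ((2 * epsT L k) * (2 * epsT L k - lam)))
        ≤ Real.pi ^ 2 / 8 * R * (gres L lam k * (phase L k 0).re) := by
    intro k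
    rw [RateLemma.phase_zero_re, mul_one]
    by_cases hk : k = 0
    · subst hk; simp [gres]
    · rw [if_neg hk]
      simp only [gres, if_neg hk]
      have hε : eps1 L ≤ epsT L k := eps1_le_epsT L hL2 hk
      have hε₁ := RateLemma.eps1_pos_of_two_le L hL2
      have ha : 0 < 2 * epsT L k := by linarith
      have hb : 0 < 2 * epsT L k - lam := by linarith
      -- numerator
      rw [RateLemma.phaseReCentred_holds L k r]
      have hcos : 1 - Real.cos (RateLemma.kdotC L k r) ≤ (RateLemma.kdotC L k r) ^ 2 / 2 :=
        (RateLemma.one_sub_cos_le_min _).trans (min_le_right _ _)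
      have hkd : (RateLemma.kdotC L k r) ^ 2
          ≤ (2 * Real.pi / L) ^ 2 * (((k.1.valMinAbs * x + k.2.valMinAbs * y : ℤ)) : ℝ) ^ 2 := by
        rw [hr]; exact RateLemma.kdotC_sq_le L k x y
      have hCS : (((k.1.valMinAbs * x + k.2.valMinAbs * y : ℤ)) : ℝ) ^ 2
          ≤ ((((k.1.valMinAbs : ℤ)) : ℝ) ^ 2 + (((k.2.valMinAbs : ℤ)) : ℝ) ^ 2) * R := by
        push_cast
        rw [hR]
        nlinarith [sq_nonneg ((((k.1.valMinAbs : ℤ)) : ℝ) * y - (((k.2.valMinAbs : ℤ)) : ℝ) * x)]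
      have hJ := theta_sq_normSq_le L k
      have hnum : 1 - Real.cos (RateLemma.kdotC L k r) ≤ Real.pi ^ 2 / 8 * R * (2 * epsT L k) := by
        have h3 : (2 * Real.pi / L) ^ 2 * (((k.1.valMinAbs * x + k.2.valMinAbs * y : ℤ)) : ℝ) ^ 2
            ≤ Real.pi ^ 2 / 4 * (2 * epsT L k) * R := by
          calc (2 * Real.pi / L) ^ 2 * (((k.1.valMinAbs * x + k.2.valMinAbs * y : ℤ)) : ℝ) ^ 2
              ≤ (2 * Real.pi / L) ^ 2 * (((((k.1.valMinAbs : ℤ)) : ℝ) ^ 2 + (((k.2.valMinAbs : ℤ)) : ℝ) ^ 2) * R) :=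
                mul_le_mul_of_nonneg_left hCS (by positivity)
            _ = ((2 * Real.pi / L) ^ 2 * ((((k.1.valMinAbs : ℤ)) : ℝ) ^ 2 + (((k.2.valMinAbs : ℤ)) : ℝ) ^ 2)) * R := by ring
            _ ≤ (Real.pi ^ 2 / 4 * (2 * epsT L k)) * R := mul_le_mul_of_nonneg_right hJ hR0
        linarith
      -- divide
      rw [div_le_iff₀ (by positivity)]
      calc 1 - Real.cos (RateLemma.kdotC L k r) ≤ Real.pi ^ 2 / 8 * R * (2 * epsT L k) := hnum
        _ = Real.pi ^ 2 / 8 * R * (1 / (2 * epsT L k - lam)) * (2 * epsT L k * (2 * epsT L k - lam)) := by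
            field_simp
  -- sum and scale
  have hsum := Finset.sum_le_sum (fun k (_ : k ∈ (Finset.univ : Finset (Tor L))) => hterm k)
  rw [← Finset.mul_sum] at hsum
  rw [show Real.pi ^ 2 / 8 * R * lam * ((∑ k : Tor L, gres L lam k * (phase L k 0).re) / (L : ℝ) ^ 2)
      = lam * (Real.pi ^ 2 / 8 * R * ∑ k : Tor L, gres L lam k * (phase L k 0).re) / (L : ℝ) ^ 2 by ring]
  apply div_le_div_of_nonneg_right _ hV.le
  exact mul_le_mul_of_nonneg_left hsum h0

/-- ★ KT-REGIME WINDOW λ-PART: for `L ≥ 64`, `0 ≤ ν ≤ 0.07`, `λ = ν(2π/L)²`: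
`δ_λ(x,y) ≤ ν(x² + y²)(7.76 ln L + 3.3)/L²`. [folklore] -/
theorem lamPart_KT_le (hL : 64 ≤ L) (ν : ℝ) (hν0 : 0 ≤ ν) (hν : ν ≤ 0.07) (x y : ℤ) :
    RateLemma.lamPart L (ν * (2 * Real.pi / L) ^ 2) (((x : ZMod L)), ((y : ZMod L)))
      ≤ ν * ((x : ℝ) ^ 2 + (y : ℝ) ^ 2) * (7.76 * Real.log L + 3.3) / (L : ℝ) ^ 2 := by
  have hπlo := Real.pi_gt_d6
  have hπhi := Real.pi_lt_d6
  have hπ := Real.pi_pos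
  have hL0 : (0 : ℝ) < L := by exact_mod_cast (show 0 < L by omega)
  have hL64 : (64 : ℝ) ≤ L := by exact_mod_cast hL
  set θ : ℝ := 2 * Real.pi / L with hθ
  have hν4 : ν < 4 / Real.pi ^ 2 := by
    rw [lt_div_iff₀ (by positivity)]; nlinarith
  have hεJ : 2 / Real.pi ^ 2 * θ ^ 2 ≤ eps1 L := by rw [hθ]; exact RateLemma.eps1_ge_jordan L (by omega)
  have hlam0 : 0 ≤ ν * θ ^ 2 := by positivity
  have hlam1 : ν * θ ^ 2 < 2 * eps1 L := by
    have h1 : ν * θ ^ 2 < 4 / Real.pi ^ 2 * θ ^ 2 := mul_lt_mul_of_pos_right hν4 (by positivity)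
    have h2 : 4 / Real.pi ^ 2 * θ ^ 2 = 2 * (2 / Real.pi ^ 2 * θ ^ 2) := by ring
    linarith
  have hmain := lamPart_le_capacity L (by omega) (ν * θ ^ 2) hlam0 hlam1 x y
  have hcap := (capacity_KT_bounds L hL ν hν0 hν).2
  rw [hθ] at hmain ⊢
  set R : ℝ := (x : ℝ) ^ 2 + (y : ℝ) ^ 2 with hR
  have hR0 : 0 ≤ R := by positivity
  have hlogL : 0 ≤ Real.log L := Real.log_nonneg (by linarith)
  -- `G̃_λ(0) ≤ log L/(2π) + 0.0674`
  have hG : Gres L (ν * (2 * Real.pi / L) ^ 2) 0 ≤ Real.log L / (2 * Real.pi) + 0.0674 := by nlinarith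
  have hG0 : 0 ≤ Real.log L / (2 * Real.pi) + 0.0674 := by positivity
  refine hmain.trans ?_
  -- `(π²/8) R (ν θ²) G ≤ ν R (7.76 log L + 3.3)/L²`
  have e1 : Real.pi ^ 2 / 8 * R * (ν * (2 * Real.pi / L) ^ 2) * Gres L (ν * (2 * Real.pi / L) ^ 2) 0
      = (ν * R / (L : ℝ) ^ 2) * (Real.pi ^ 4 / 2 * Gres L (ν * (2 * Real.pi / L) ^ 2) 0) := by
    field_simp; ring
  have e2 : ν * R * (7.76 * Real.log L + 3.3) / (L : ℝ) ^ 2 = (ν * R / (L : ℝ) ^ 2) * (7.76 * Real.log L + 3.3) := by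
    ring
  rw [e1, e2]
  apply mul_le_mul_of_nonneg_left _ (by positivity)
  have hπ2 : Real.pi ^ 2 ≤ 9.8697 := by nlinarith
  have hπ3 : Real.pi ^ 3 ≤ 31.007 := by nlinarith [mul_le_mul hπ2 hπhi.le hπ.le (by norm_num)]
  have hπ4 : Real.pi ^ 4 ≤ 97.42 := by nlinarith [mul_le_mul hπ2 hπ2 (by positivity) (by norm_num)]
  have h1 : Real.pi ^ 4 / 2 * Gres L (ν * (2 * Real.pi / L) ^ 2) 0
      ≤ Real.pi ^ 4 / 2 * (Real.log L / (2 * Real.pi) + 0.0674) :=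
    mul_le_mul_of_nonneg_left hG (by positivity)
  have h2 : Real.pi ^ 4 / 2 * (Real.log L / (2 * Real.pi) + 0.0674)
      = Real.pi ^ 3 / 4 * Real.log L + Real.pi ^ 4 / 2 * 0.0674 := by
    field_simp; ring
  rw [h2] at h1
  nlinarith [mul_le_mul_of_nonneg_right hπ3 hlogL]

end CapacityConst

end Summit.HubbardSuperconductivity.HubbardSuperconductivity.Theorems.AnisotropyChord.Transfer.Fibre3

end
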